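import Mathlib
import Summits.Ventures.HodgeRepro0.P4K3LatticeDefsGp
import Summits.Ventures.HodgeRepro0.P4K3LatticeGp1
import Summits.Ventures.HodgeRepro0.P4K3LatticeGp2
import Summits.Ventures.HodgeRepro0.P4K3LatticeGp3
import Summits.Ventures.HodgeRepro0.P4K3LatticeGp4

/-!
# P4K3LatticeGp (seat p4) — `|det G'| = 5` from the four kernel-evaluated products

See `P4K3LatticeDefsG` (and `DefsGp`, `DefsM`) for the data and the paper side (proofs/p4-k3-route-check.md §4). Assembles the diagonalisation
`P' * G' * Q' = Matrix.diagonal d'` from the product modules and reads off the determinant; no heavy evaluation here.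
-/

namespace HodgeRepro0.P4K3Lattice

/-- Diagonalisation of `G'` by unimodular matrices. -/
theorem P'_G'_Q' : P' * G' * Q' = Matrix.diagonal d' := by
  rw [P'_mul_G', PGm'_mul_Q', Dm'_eq]

/-- `|det G'| = 5`. -/
theorem abs_det_G' : |G'.det| = 5 := by
  have h := congrArg Matrix.det P'_G'_Q'
  rw [Matrix.det_mul, Matrix.det_mul, Matrix.det_diagonal] at h
  have hP := det_unit_of_mul_eq_one P'_mul_Pinv'
  have hQ := det_unit_of_mul_eq_one Q'_mul_Qinv'
  have hd : ∏ i, d' i = -5 := by rw [← FinVec.prod_eq]; rfl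
  rw [hd] at h
  have : |P'.det| * |G'.det| * |Q'.det| = 5 := by rw [← abs_mul, ← abs_mul, h]; norm_num
  rw [hP, hQ] at this; simpa using this

end HodgeRepro0.P4K3Lattice
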